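import Summits.MatrixMultiplication.OmegaCensus.SmallFormats.MatMulM22Length3m3Frames
import Mathlib.Tactic.Linarith
import HarnessLib

/-!
# ω-census family (a): the `(8,27)` and `(9,30)` rungs over `𝔽₃` REDUCED to the type-F half of the length-`3m+3` frame law

Cell `pub-omega` (unit `pub-omega-tensor`, gen 38), topic `Summits/MatrixMultiplication/OmegaCensus` (sub-folder
`SmallFormats`). Framing (verbatim): lottery ticket; floor = certified bounds/negative ranges. HONEST FRAMING: CONDITIONAL rungs
(bookkeeping that fixes exactly what is still missing) plus two tiny unconditional count certificates. Nothing here is a bound on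
`ω`, and the hypothesis `TF2` below is NOT proved in the tree.

## The hypothesis (frame language, Alekseev orientation `⟨n,2,2⟩`)

`TF2(n, d)`: in every length-`d` bilinear computation of `⟨n,2,2⟩` over `𝔽₃`, at most TWO indices are of type F (`p_t = 0`, i.e. the
X-form reads only the second column of `y`). By the type-F count (p714035 `FramePlaneCap.card_add_two_mul_le_two_mul_card_J`:
`#F + 2n ≤ 2|J|`) and the length-`3n+3` frame law of this generation (p716980 `Frame3m3.card_J_le`: `|J| ≤ n + 2` for `n ≥ 8`),
`TF2(n, 3n+3)` is exactly the statement «a frame with parameters `(2n+1, n+2)` has at most two type-F indices» — the open half of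
the length-`3n+3` law (tensor g38 STATUS / HANDOFF).

## What is proved here

* `FramePlaneCap.card_le_two_of_mulVec_of_typeF` — transport (any `n`, `d`, field `𝔽₃`... stated over any field): `TF2(n,d)` ⇒ every
  COLUMN plane `{U : U λ = 0}` carries at most two X-forms of any length-`d` computation of `⟨2,2,n⟩` (transpose-dual symmetry
  `exists_xMarginal_eq_transpose`, sandwich `exists_xMarginal_eq_sandwich`, transposed computation `exists_trComp`).
* `Enum723.no_cnt827_col2`, `Enum723.no_cnt930_col2` — UNCONDITIONAL count certificates (one Farkas vector each, found by exact
  rational LP on the desk, tensor g38 `desk/lp_lean.py`): no count vector over tensor g31's 40 classes has total `27` with the four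
  COLUMN loads `≤ 2` and the `𝔽₉`-pencil loads `≤ 27 − 24 = 3` (indeed classes `36–39` and `40–45` cover all 40 classes:
  `4·2 + 6·3 = 26 < 27`); none has total `30` with column loads `36, 37 ≤ 2` and the J-pencil loads `4,7,13,14,21,22,29,30 ≤ 3`.
* `Enum723.twentyeight_le_tensorRank_228_gf3_of_typeF`, `tensorRank_228_gf3_eq_of_typeF` — `TF2(8,27)` ⇒ `R_𝔽₃(⟨2,2,8⟩) = 28`;
  `Enum723.thirtyone_le_tensorRank_229_gf3_of_typeF` — `TF2(9,30)` ⇒ `31 ≤ R_𝔽₃(⟨2,2,9⟩)` (pipeline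
  `succ_le_tensorRank_22n_of_orbit_census` with the half law plus one, `C = 9` resp. `10`).

The first certificate says more, informally: a hypothetical 27-term scheme for `⟨2,2,8⟩` over `𝔽₃` has at least `27 − 18 = 9`
rank-one X-forms, hence (pigeonhole over the four planes of each family) a row plane AND a column plane of load `≥ 3`, i.e. — by
`Frame3m3.stepD_three` — a `(17, 10)`-frame with `≥ 3` type-F indices in both orientations.
-/

namespace Summit.MatrixMultiplication.OmegaCensus.SmallFormats

open Finset Matrix Module
open Literature.Computability.AlgebraicComplexity
open Summit.MatrixMultiplication.OmegaCensus.RankOnePlaneCapGeneral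

namespace FramePlaneCap

variable {k : Type*} [Field k] {n : ℕ} {ι : Type*} [Fintype ι]

/-- An invertible `2 × 2` matrix with prescribed nonzero first row (copy of the private helper of `MatMul225FramePlaneCap`). -/
private theorem exists_det_ne_zero_row₄ (lam : Fin 2 → k) (hlam : lam ≠ 0) :
    ∃ P : Matrix (Fin 2) (Fin 2) k, P.det ≠ 0 ∧ ∀ d, P 0 d = lam d := by
  by_cases h0 : lam 0 = 0
  · have h1 : lam 1 ≠ 0 := by
      intro h1; apply hlam; funext j; fin_cases j <;> simp [h0, h1]
    refine ⟨!![lam 0, lam 1; 1, 0], ?_, fun d => by fin_cases d <;> rfl⟩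
    rw [Matrix.det_fin_two_of]; simpa [h0] using h1
  · refine ⟨!![lam 0, lam 1; 0, 1], ?_, fun d => by fin_cases d <;> rfl⟩
    rw [Matrix.det_fin_two_of]; simpa using h0

/-- **Transport of the type-F bound to the ROW planes** (any field, any `n`, `d`): if every length-`d` computation of `⟨n,2,2⟩` has
at most two type-F indices, then in every length-`d` computation of `⟨2,2,n⟩` every row plane `{U : λᵀ U = 0}` carries at most two
X-forms. -/
theorem card_le_two_of_vecMul_of_typeF {d : ℕ}
    (H : ∀ (β' : BilinComp (mulBilin k n 2 2) ι), Fintype.card ι = d →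
      ∀ s : Finset ι, (∀ t ∈ s, Alekseev2015.pvec β' t = 0) → s.card ≤ 2)
    (β : BilinComp (mulBilin k 2 2 n) ι) (hι : Fintype.card ι = d) (lam : Fin 2 → k) (hlam : lam ≠ 0)
    (s : Finset ι) (hs : ∀ i ∈ s, Matrix.vecMul lam (xMarginal β i) = 0) : s.card ≤ 2 := by
  classical
  obtain ⟨P, hP, hrow⟩ := exists_det_ne_zero_row₄ lam hlam
  obtain ⟨β₁, hβ₁⟩ := exists_xMarginal_eq_sandwich β P 1 hP (by simp)
  obtain ⟨β', hβ'⟩ := exists_trComp β₁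
  refine H β' hι s fun t ht => ?_
  funext j
  have key : (P * xMarginal β t) 0 j = Matrix.vecMul lam (xMarginal β t) j := by
    simp only [Matrix.mul_apply, Matrix.vecMul, dotProduct, hrow]
  rw [hβ', hβ₁, Matrix.mul_one, key, hs t ht]

/-- **Transport of the type-F bound to the COLUMN planes** (any field, any `n`, `d`): `TF2(n,d)` ⇒ `#{i : U_i λ = 0} ≤ 2` in every
length-`d` computation of `⟨2,2,n⟩` (transpose-dual symmetry, then the row case). -/
theorem card_le_two_of_mulVec_of_typeF {d : ℕ}
    (H : ∀ (β' : BilinComp (mulBilin k n 2 2) ι), Fintype.card ι = d →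
      ∀ s : Finset ι, (∀ t ∈ s, Alekseev2015.pvec β' t = 0) → s.card ≤ 2)
    (β : BilinComp (mulBilin k 2 2 n) ι) (hι : Fintype.card ι = d) (lam : Fin 2 → k) (hlam : lam ≠ 0)
    (s : Finset ι) (hs : ∀ i ∈ s, Matrix.mulVec (xMarginal β i) lam = 0) : s.card ≤ 2 := by
  classical
  obtain ⟨β₁, hβ₁⟩ := exists_xMarginal_eq_transpose β
  refine card_le_two_of_vecMul_of_typeF H β₁ hι lam hlam s fun i hi => ?_
  rw [hβ₁, Matrix.vecMul_transpose, hs i hi]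

end FramePlaneCap

namespace Enum723

open FramePlaneCap

/-- **`TF2(n, r)` in census coordinates** (`𝔽₃`, tensor g31's clauses `36–39`): the four COLUMN loads of the X-marginal of a
length-`r` computation of `⟨2,2,n⟩` with no dead product are at most `2`. -/
theorem load_col_le_two_of_typeF {n r : ℕ}
    (H : ∀ (β' : BilinComp (mulBilin (ZMod 3) n 2 2) (Fin r)), Fintype.card (Fin r) = r →
      ∀ s : Finset (Fin r), (∀ t ∈ s, Alekseev2015.pvec β' t = 0) → s.card ≤ 2)
    (β : BilinComp (mulBilin (ZMod 3) 2 2 n) (Fin r)) (hm : ∀ i, xMarginal β i ≠ 0) :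
    ∀ kk, 36 ≤ kk → kk < 40 → load (cnt (xMarginal β)) kk ≤ 2 := by
  classical
  intro kk hk1 hk2
  rw [← card_filter_csem (xMarginal β) hm kk (by omega)]
  have h1 : ¬ kk < 32 := by omega
  have h2 : ¬ kk < 36 := by omega
  refine card_le_two_of_mulVec_of_typeF H β (by simp) (lamF (kk - 36)) (lamF_ne _ (by omega)) _ fun i hi => ?_
  rw [Finset.mem_filter] at hi
  have h := hi.2
  simp only [csem, if_neg h1, if_neg h2, if_pos hk2, mflat_apply] at h
  exact (mulVec_eq_zero_iff _ _).mpr h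

set_option maxHeartbeats 8000000 in
/-- **Count certificate at `(8, 27)` from the column cap `2` alone** (one Farkas vector: the column planes `36–39` and the
`𝔽₉`-pencil planes `40–45` cover all 40 classes, `4·2 + 6·3 = 26 < 27`). UNCONDITIONAL. -/
theorem no_cnt827_col2 (c : ℕ → ℕ) (hCol : ∀ k, 36 ≤ k → k < 40 → load c k ≤ 2)
    (hQ : ∀ k, 40 ≤ k → k < 58 → load c k + 3 * 8 ≤ 27) (ht : tot c = 27) : False := by
  have l36 := hCol 36 (by norm_num) (by norm_num)
  have l37 := hCol 37 (by norm_num) (by norm_num)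
  have l38 := hCol 38 (by norm_num) (by norm_num)
  have l39 := hCol 39 (by norm_num) (by norm_num)
  have l40 := hQ 40 (by norm_num) (by norm_num)
  have l41 := hQ 41 (by norm_num) (by norm_num)
  have l42 := hQ 42 (by norm_num) (by norm_num)
  have l43 := hQ 43 (by norm_num) (by norm_num)
  have l44 := hQ 44 (by norm_num) (by norm_num)
  have l45 := hQ 45 (by norm_num) (by norm_num)
  simp only [load, tot, Finset.sum_range_succ, Finset.sum_range_zero, inc, incL, List.getD_cons_succ, List.getD_cons_zero,
    mul_one, mul_zero, add_zero, zero_add] at l36 l37 l38 l39 l40 l41 l42 l43 l44 l45 ht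
  omega

set_option maxHeartbeats 8000000 in
/-- **Count certificate at `(9, 30)` from the column cap `2`** (one Farkas vector: J-pencil planes `4,7,13,14,21,22,29,30` and column
planes `36, 37`, each with weight `1/2`). UNCONDITIONAL. -/
theorem no_cnt930_col2 (c : ℕ → ℕ) (hJ : ∀ k, k < 32 → load c k + 3 * 9 ≤ 30)
    (hCol : ∀ k, 36 ≤ k → k < 40 → load c k ≤ 2) (ht : tot c = 30) : False := by
  have l4 := hJ 4 (by norm_num)
  have l7 := hJ 7 (by norm_num)
  have l13 := hJ 13 (by norm_num)
  have l14 := hJ 14 (by norm_num)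
  have l21 := hJ 21 (by norm_num)
  have l22 := hJ 22 (by norm_num)
  have l29 := hJ 29 (by norm_num)
  have l30 := hJ 30 (by norm_num)
  have l36 := hCol 36 (by norm_num) (by norm_num)
  have l37 := hCol 37 (by norm_num) (by norm_num)
  simp only [load, tot, Finset.sum_range_succ, Finset.sum_range_zero, inc, incL, List.getD_cons_succ, List.getD_cons_zero,
    mul_one, mul_zero, add_zero, zero_add] at l4 l7 l13 l14 l21 l22 l29 l30 l36 l37 ht
  omega

/-- **`TF2(8, 27)` ⇒ `28 ≤ R_𝔽₃(⟨2,2,8⟩)`** (pipeline: kernel floor `27`, half law plus one with `C = 9`, the column cap from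
`TF2`, certificate `no_cnt827_col2`). CONDITIONAL on the hypothesis. -/
theorem twentyeight_le_tensorRank_228_gf3_of_typeF
    (H : ∀ (β' : BilinComp (mulBilin (ZMod 3) 8 2 2) (Fin 27)), Fintype.card (Fin 27) = 27 →
      ∀ s : Finset (Fin 27), (∀ t ∈ s, Alekseev2015.pvec β' t = 0) → s.card ≤ 2) :
    28 ≤ tensorRank (matMulTensor (ZMod 3) 2 2 8) := by
  classical
  have hr : 27 ≤ tensorRank (matMulTensor (ZMod 3) 2 2 8) := by
    have h := (tensorRank_matMulTensor_22n_gf3_window 8 (by norm_num)).1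
    have h' : max (3 * 8 + 2) ((36 * 8 + 10) / 11) = 27 := by norm_num
    omega
  refine succ_le_tensorRank_22n_of_orbit_census (k := ZMod 3) (n := 8) 27 ∅ (fun β => ?_) (by simp)
  exfalso
  have hm := xMarginal_ne_zero_of_le_tensorRank hr β
  obtain ⟨-, -, hQ, -, ht⟩ := cnt_clauses (C := 9) (xMarginal β) hm (xCaps3_xMarginal β) fun X₀ hX₀ => by
    have h := invLineCapHalfPlus_xMarginal (n := 8) (by norm_num) β X₀ hX₀; omega
  exact no_cnt827_col2 _ (load_col_le_two_of_typeF H β hm) hQ ht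

/-- **`TF2(8, 27)` ⇒ `R_𝔽₃(⟨2,2,8⟩) = 28`** (Hopcroft–Kerr upper bound in the tree). CONDITIONAL on the hypothesis. -/
theorem tensorRank_228_gf3_eq_of_typeF
    (H : ∀ (β' : BilinComp (mulBilin (ZMod 3) 8 2 2) (Fin 27)), Fintype.card (Fin 27) = 27 →
      ∀ s : Finset (Fin 27), (∀ t ∈ s, Alekseev2015.pvec β' t = 0) → s.card ≤ 2) :
    tensorRank (matMulTensor (ZMod 3) 2 2 8) = 28 := by
  have h := (tensorRank_matMulTensor_22n_gf3_window 8 (by norm_num)).2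
  have h2 := twentyeight_le_tensorRank_228_gf3_of_typeF H
  omega

/-- **`TF2(9, 30)` ⇒ `31 ≤ R_𝔽₃(⟨2,2,9⟩)`** (pipeline: kernel floor `30`, half law plus one with `C = 10`, the column cap from
`TF2`, certificate `no_cnt930_col2`). CONDITIONAL on the hypothesis. -/
theorem thirtyone_le_tensorRank_229_gf3_of_typeF
    (H : ∀ (β' : BilinComp (mulBilin (ZMod 3) 9 2 2) (Fin 30)), Fintype.card (Fin 30) = 30 →
      ∀ s : Finset (Fin 30), (∀ t ∈ s, Alekseev2015.pvec β' t = 0) → s.card ≤ 2) :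
    31 ≤ tensorRank (matMulTensor (ZMod 3) 2 2 9) := by
  classical
  have hr : 30 ≤ tensorRank (matMulTensor (ZMod 3) 2 2 9) := by
    have h := (tensorRank_matMulTensor_22n_gf3_window 9 (by norm_num)).1
    have h' : max (3 * 9 + 2) ((36 * 9 + 10) / 11) = 30 := by norm_num
    omega
  refine succ_le_tensorRank_22n_of_orbit_census (k := ZMod 3) (n := 9) 30 ∅ (fun β => ?_) (by simp)
  exfalso
  have hm := xMarginal_ne_zero_of_le_tensorRank hr β
  obtain ⟨hJ, -, -, -, ht⟩ := cnt_clauses (C := 10) (xMarginal β) hm (xCaps3_xMarginal β) fun X₀ hX₀ => by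
    have h := invLineCapHalfPlus_xMarginal (n := 9) (by norm_num) β X₀ hX₀; omega
  exact no_cnt930_col2 _ hJ (load_col_le_two_of_typeF H β hm) ht

end Enum723

end Summit.MatrixMultiplication.OmegaCensus.SmallFormats
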